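import Summits.KontsevichZagierPeriods.KontsevichZagierPeriods.Theses.SymplecticScissors
import Summits.KontsevichZagierPeriods.KontsevichZagierPeriods.Theorems.UnfoldedStokesStokesGenerationLineReductionNamed

/-!
# `VolumeFormOffPlane` (stmt-KontsevichZagierPeriods-14935): the strategist's DECOMPOSITION of the
# off-plane frame — arithmetic of cube integrals (Ayoub's Conjecture 1.1) ∧ geometry of solids off
# the plane (cube–Nash normal form by moves), joined by the landed Ayoub compiler

Route SymplecticScissors, crux `VolumeFormOffPlane` (two integrand-`1` representations of a
dimension `N ≠ 2` with equal volume are KZ-equivalent). The crux is the frame `VolumeForm` off the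
plane and is summit-equivalent verbatim (`Theorems/VolumeFormOffPlane/Negative/Core.lean`); its
registered line `Sketch` (40+ landed sector theorems) ends at a conceded residual that is the crux
again (exempt-46 re-examination 2026-08-17: PIECE-EQUIVALENT). This file lands the GLUE of a typed
decomposition whose two open pieces are materially different from the crux, from the summit and
from each other, and whose assembly is a real construction:

* **(A) arithmetic** — `TypeAGeneration` := Ayoub's Conjecture 1.1 / Fresán's Conjecture 3.5,
  verbatim the tree's conjecture leaf `TypeAGenerationConjecture`
  (`Theorems/TypeAGenerationConjecture.lean`): on the algebra `𝒪_{k-alg}(𝔻̄^∞)` of algebraic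
  power series on the closed polydisc (`AyoubRel.Oan`), the kernel of `∫_{[0,1]^∞}` (`AyoubRel.intC`)
  is the `k`-span of the Stokes elements `∂G/∂zᵢ − G|_{zᵢ=1} + G|_{zᵢ=0}` (`AyoubRel.relAC`). It
  constrains VALUES of integrals and says nothing about domains or moves.
* **(G) geometric** — `CubeNashNormalForm` := verbatim the item stmt-KontsevichZagierPeriods-3574
  (route LiftingCriteria): every difference of KZ-rational representations is, INSIDE THE MOVES, a
  `ℤ`-combination of closed-cube representations with `ℚ`-semialgebraic integrands real-analytic
  near the cube. It constrains no value of any integral; by the landed reductions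
  `LiftingCriteria.CubeNashNormalFormReduction.cubeNashNormalForm_of_volume` /
  `…DimLeOne.cubeNashNormalForm_of_volume_three` its open core is exactly the cube–Nash normal form
  of bounded integrand-`1` SOLIDS of dimension `≥ 3` (embedded resolution of `∂S` over `ℝ` realised
  by moves) — the plane (`of_mem_of_volume_two`, Newton–Puiseux) and the line are in the tree. So
  (G) is the frame's own geometry OFF THE PLANE, as the crux is the frame off the plane.

Assembly (`volumeForm_of_subs`, `volumeFormOffPlane_of_subs`): for integrand-`1` representations
`r`, `r'` of one dimension with equal volume, (G) puts `[r] − [r'] ≡ Σ εᵢ [sᵢ]` (cube–Nash) inside the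
moves; soundness of the calculus (`KZ.relations_le_ker_eval_holds`) transfers `value r = value r'` to
`eval (Σ εᵢ [sᵢ]) = 0`; and the LANDED AYOUB COMPILER
`StokesGenerationLine.sum_cubeNash_mem_relations_of_typeAGenerationConjecture` ((A) alone ⇒ the
Kontsevich–Zagier conjecture for cube–Nash combinations: merge the cubes to one dimension
`stub_mergeCubes` p99241, Nash integrand ↦ real-analytic germ `stub_nashToGerm` p101780, germ ↦
element of `𝒪_{ℚ̄-alg}(𝔻̄^∞)` with the same integral `stub_germToOan` p109733, (A) ⇒ a `ℚ̄`-combination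
of type-(a) elements, type-(a) elements ↦ instances of the four moves `stub_spanToReps` p113092 with
the cube calibration `stub_cubeCalibration` p97569) turns that combination into a relation; the two
differences telescope. Neither piece is consumed trivially: (G) supplies the witnesses the compiler
acts on, (A) drives the compiler, and the frame's hypotheses enter through KZ-rationality of
integrand-`1` representations and soundness. This is the `N`-dimensional twin of the route's own
planar layer (input crux `RealOnePeriodRelations` = Huber–Wüstholz in real clothes ∧ the PROVED
`PlanarCompiler`).

Strength bookkeeping (no converse is claimed): (A) ∧ (G) ⇒ frame ⇒ summit; (A) alone reaches
dimension `≤ 1` and cube–Nash combinations only (`…LineReductionNamed`, §4); (G) alone reaches no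
value; summit ⇒ (A) and summit ⇒ (G) are neither in the tree nor in print for the semialgebraic
calculus (Ayoub 2015 Fait 1.4 compares Conjecture 1.1 with the COHOMOLOGICAL formal period algebra,
an identification the summit Statement explicitly does not make).

References: M. Kontsevich, D. Zagier, *Periods* (2001), §1.2 Conjecture 1; J. Ayoub, *Une version
relative de la conjecture des périodes de Kontsevich–Zagier*, Ann. of Math. 181 (2015), Conj. 1.1,
Rem. 1.2, Fait 1.4; J. Fresán, *Une introduction aux périodes* (2024), Conj. 3.5; H. Hironaka (1964)
/ E. Bierstone, P. Milman (1988) §4 (embedded resolution over `ℝ`, the open part of (G)).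
-/

noncomputable section

set_option linter.dupNamespace false

namespace Summit.KontsevichZagierPeriods.SymplecticScissors.OffPlaneSplit

open MeasureTheory Set
open Literature.NumberTheory.Transcendental
open Literature.NumberTheory.Transcendental.KZ
open Summit.KontsevichZagierPeriods.KontsevichZagierPeriods (TypeAGenerationConjecture)
open Summit.KontsevichZagierPeriods.KontsevichZagierPeriods.Theses.LiftingCriteria (CubeNashNormalForm)
open Summit.KontsevichZagierPeriods.KontsevichZagierPeriods.Theses.SymplecticScissors
  (VolumeFormOffPlane VolumeForm)
open Summit.KontsevichZagierPeriods.KontsevichZagierPeriods.StokesGenerationLine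
  (sum_cubeNash_mem_relations_of_typeAGenerationConjecture)

/-- An integrand-`1` representation has the literal shape of Kontsevich–Zagier's Definition
(`p = q = 1`). [folklore] -/
theorem isRational_of_integrand_one {N : ℕ} (r : IntegralRep N)
    (hr : ∀ x ∈ r.domain, r.integrand x = 1) : r.IsRational :=
  ⟨1, 1, fun x _ => by simp, fun x hx => by simp [hr x hx]⟩

/-- **(A) ∧ (G) ⇒ the frame `VolumeForm`** (stmt-3814, every dimension): normal form of
`[r] − [r']` by (G), value `0` by soundness, relation by the landed Ayoub compiler driven by (A),
telescoping. [cite: KontsevichZagier2001, §1.2 Conjecture 1] -/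
theorem volumeForm_of_subs (hT : TypeAGenerationConjecture) (hN : CubeNashNormalForm) :
    VolumeForm := by
  classical
  intro N r r' hr hr' hv
  -- (G): the cube–Nash normal form of `[r] − [r']` inside the moves
  obtain ⟨S, nS, g, U, ε, s, hNash, hs, hNF⟩ :=
    hN N N r r' (isRational_of_integrand_one r hr) (isRational_of_integrand_one r' hr')
  -- soundness: the normal form has value `0`
  have hsum0 : eval (∑ i, ε i • of (s i)) = 0 := by
    have h := relations_le_ker_eval_holds hNF
    rw [AddMonoidHom.mem_ker, map_sub, map_sub, eval_of, eval_of, hv, sub_self, zero_sub,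
      neg_eq_zero] at h
    exact h
  -- (A) + the landed compiler: a cube–Nash combination of value `0` is a relation
  have hsum : ∑ i, ε i • of (s i) ∈ relations :=
    sum_cubeNash_mem_relations_of_typeAGenerationConjecture hT S nS g U ε s hNash hs hsum0
  -- telescope
  show of r - of r' ∈ relations
  have e : of r - of r' = (of r - of r' - ∑ i, ε i • of (s i)) + ∑ i, ε i • of (s i) := by abel
  rw [e]
  exact relations.add_mem hNF hsum

/-- **(A) ∧ (G) ⇒ the crux `VolumeFormOffPlane`** (stmt-14935), by the route-file names of the
pieces' home decls (`TypeAGenerationConjecture`, `LiftingCriteria.CubeNashNormalForm`).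
[cite: KontsevichZagier2001, §1.2 Conjecture 1] -/
theorem volumeFormOffPlane_of_typeA_of_cubeNash (hT : TypeAGenerationConjecture)
    (hN : CubeNashNormalForm) : VolumeFormOffPlane :=
  fun _ _ r r' hr hr' hv => volumeForm_of_subs hT hN r r' hr hr' hv

/-- **THE GLUE of the split `VolumeFormOffPlane ⟸ TypeAGeneration ∧ CubeNashNormalForm`**, typed by
the LITERAL statements of the two children as filed on route SymplecticScissors (first the
arithmetic piece = the body of `TypeAGenerationConjecture`, then the geometric piece = the body of
item stmt-3574): `Sub₁ → Sub₂ → Crux`. [cite: KontsevichZagier2001, §1.2 Conjecture 1] -/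
theorem volumeFormOffPlane_of_subs :
    (∀ (k : Type) [Field k] [CharZero k] (σ : k →+* ℂ), (∀ c : k, IsAlgebraic ℚ (σ c)) → ∀ F ∈ Literature.NumberTheory.Transcendental.AyoubRel.Oan σ, Literature.NumberTheory.Transcendental.AyoubRel.intC F = 0 → F ∈ Literature.NumberTheory.Transcendental.AyoubRel.kSpan σ {x : Literature.NumberTheory.Transcendental.AyoubRel.CSeries | ∃ G ∈ Literature.NumberTheory.Transcendental.AyoubRel.Oan σ, ∃ i : ℕ, x = Literature.NumberTheory.Transcendental.AyoubRel.relAC i G}) →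
    (∀ (k k' : ℕ) (r : Literature.NumberTheory.Transcendental.KZ.IntegralRep k) (r' : Literature.NumberTheory.Transcendental.KZ.IntegralRep k'), r.IsRational → r'.IsRational → ∃ (S : ℕ) (n : Fin S → ℕ) (g : (i : Fin S) → (Fin (n i) → ℝ) → ℝ) (U : (i : Fin S) → Set (Fin (n i) → ℝ)) (ε : Fin S → ℤ) (s : (i : Fin S) → Literature.NumberTheory.Transcendental.KZ.IntegralRep (n i)), (∀ i, IsOpen (U i) ∧ Set.pi Set.univ (fun _ : Fin (n i) => Set.Icc (0:ℝ) 1) ⊆ (U i) ∧ Literature.NumberTheory.Transcendental.IsSemialgebraicFunOn ℚ (U i) (g i) ∧ AnalyticOnNhd ℝ (g i) (U i)) ∧ (∀ i, (s i).domain = Set.pi Set.univ (fun _ : Fin (n i) => Set.Icc (0:ℝ) 1) ∧ ∀ z ∈ Set.pi Set.univ (fun _ : Fin (n i) => Set.Icc (0:ℝ) 1), (s i).integrand z = g i z) ∧ Literature.NumberTheory.Transcendental.KZ.of r - Literature.NumberTheory.Transcendental.KZ.of r' - ∑ i, ε i • Literature.NumberTheory.Transcendental.KZ.of (s i) ∈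 Literature.NumberTheory.Transcendental.KZ.relations) →
    Summit.KontsevichZagierPeriods.KontsevichZagierPeriods.Theses.SymplecticScissors.VolumeFormOffPlane :=
  fun hT hN => volumeFormOffPlane_of_typeA_of_cubeNash hT hN

/-- What each piece reaches ALONE (recorded so that neither child is read as the crux weakened for
free): (A) alone gives the crux in dimensions `≤ 1` — the slice the route's line `Sketch` proved
unconditionally anyway (`stub_dimLeOne`) — through the tree's
`equivalent_of_value_eq_of_dimLEOne_of_typeAGenerationConjecture`; nothing in the tree takes (A)
alone, or (G) alone, to any instance of dimension `≥ 3`. [cite: Ayoub2015, Conj. 1.1] -/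
theorem volumeFormOffPlane_dimLEOne_of_typeA (hT : TypeAGenerationConjecture) {N : ℕ} (hN : N ≤ 1)
    (r r' : IntegralRep N) (hv : r.value = r'.value) : Equivalent r r' :=
  Summit.KontsevichZagierPeriods.KontsevichZagierPeriods.StokesGenerationLine.equivalent_of_value_eq_of_dimLEOne_of_typeAGenerationConjecture
    hT hN hN r r' hv

/-! ## The route's own names (route file rev ≥ 26: children `TypeAGeneration` stmt-18392,
`CubeNashNormalForm` stmt-3574, glue item `OffPlaneSplitGlue` stmt-18438) -/

/-- The route decl `SymplecticScissors.TypeAGeneration` (stmt-18392) IS the conjecture leaf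
`TypeAGenerationConjecture` (definitional unfolding). [cite: Ayoub2015, Conj. 1.1] -/
theorem typeAGeneration_iff_leaf :
    Summit.KontsevichZagierPeriods.KontsevichZagierPeriods.Theses.SymplecticScissors.TypeAGeneration ↔
      TypeAGenerationConjecture :=
  Iff.rfl

/-- The route decl `SymplecticScissors.CubeNashNormalForm` (item stmt-3574 attached to this route)
IS `LiftingCriteria.CubeNashNormalForm` (definitional unfolding). [folklore] -/
theorem cubeNashNormalForm_iff_liftingCriteria :
    Summit.KontsevichZagierPeriods.KontsevichZagierPeriods.Theses.SymplecticScissors.CubeNashNormalForm ↔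
      CubeNashNormalForm :=
  Iff.rfl

/-- **Item stmt-KontsevichZagierPeriods-18438 `OffPlaneSplitGlue`, as filed** (the glue of the split
`VolumeFormOffPlane ⟸ TypeAGeneration ∧ CubeNashNormalForm`, by the route's own decl names):
`TypeAGeneration → CubeNashNormalForm → VolumeFormOffPlane`. Unconditional.
[cite: KontsevichZagier2001, §1.2 Conjecture 1] -/
theorem offPlaneSplitGlue_proof :
    Summit.KontsevichZagierPeriods.KontsevichZagierPeriods.Theses.SymplecticScissors.OffPlaneSplitGlue :=
  fun hT hN => volumeFormOffPlane_of_typeA_of_cubeNash hT hN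

end Summit.KontsevichZagierPeriods.SymplecticScissors.OffPlaneSplit

end
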